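import Literature.Barriers.AnomalousDissipation.ConvexIntegrationNonLerayEnergyCeiling
import HarnessLib

/-!
# Barrier (AnomalousDissipation), second narrowed companion of `ConvexIntegrationNonLeray`:
  the dissipation budget of a `C⁰_t L²` Leray–Hopf realisation is the energy drop of the limit

D-0021 barrier audit (2026-08-17, generation 2) of
`Literature/Barriers/AnomalousDissipation/ConvexIntegrationNonLeray` and its proof file
`…Proofs`. The parent block bars the "transfer of the Onsager-flexibility constructions … into a
witness for `Literature.Turb.ZerothLaw`" on the ground that the Leray–Hopf (or classical)
vanishing-viscosity realisation of a convex-integration flow is a documented open problem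
(Buckmaster–Vicol 2019, §1.2; Bruè–De Lellis 2023, §2; Cheskidov–Peng 2025, Rem. 1.5), the printed
reach being the weak (Oseen) class of Buckmaster–Vicol 2019, Thm. 1.3 (tree theorem
`BuckmasterVicol2019_thm13_holds`). The first audit narrowed this by the *energy ceiling*
(`ConvexIntegrationNonLerayEnergyCeilingNarrow`: energy-gaining flows are excluded outright). This
file adds the first-order companion, the *dissipation budget*: in the same convergence mode —
`sup_{t ∈ [0,T]} ‖v_n(t) - u(t)‖_{L²} → 0` with data `u₀ⁿ → u(0)` in `L²` — Leray–Hopf approximants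
`v_n` (viscosities `ν_n`, forces `f_n`) satisfy, for every `δ > 0` and all large `n`,

  `ν_n ∫₀ᵀ ‖∇v_n‖₂² ≤ E(u(0)) - E(u(T)) + W + δ`,   `W = lim_n ∫₀ᵀ (f_n, v_n)`,

because the Leray–Hopf energy inequality from `0` bounds the dissipation by
`E(u₀ⁿ) - E(v_n(T)) + ∫₀ᵀ(f_n, v_n)` and both energies converge. Unforced (`W = 0`): the anomaly a
Leray–Hopf realisation can transmit is at most the realised flow's energy drop; an
energy-conservative flow — every witness of `Literature.Analysis.FluidPDE.onsager_flexibility` for a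
constant profile (BDLSV 2019, Thm. 1.1), every weak Euler flow in `C^β`, `β > 1/3`
(Constantin–E–Titi 1994) — transmits none, *whether or not* the open realisation exists for it, and
with no regularity or uniform bound assumed on the approximants (contrast the regular-limit
barriers `BrenierDeLellisSzekelyhidi2011_cor1`, `BrueDeLellis2023_noAnomaly_beforeEulerSingularity`,
where strong convergence is *derived* from weak–strong uniqueness). For the summit this pins the
Euler-limit mechanism (route EulerLimit) to STRICTLY dissipative realised flows and caps the
harvest by the designed energy loss; it is the `T³`/Leray–Hopf reading of the bookkeeping
`D(t) ≤ ‖u_in‖² - ‖u(t)‖² + W(t)` of Cheskidov 2023, §1.1 and Cheskidov–Peng 2025, (1.5)–(1.9).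

## What is proved

* `tendsto_toReal_eLpNorm_of_tendsto_sub`, `tendsto_kineticEnergy_of_tendsto_sub` — `L²` norms and
  kinetic energies converge along an `L²`-convergent sequence.
* `lerayHopfLimit_dissipation_le` — the budget with forces and limiting work `W` (main lemma);
  `lerayHopfLimit_dissipation_le_energyDrop` — unforced form;
  `lerayHopfLimit_eventually_dissipation_lt` — no anomaly of size `ε` when the energy drop is `< ε`;
  `lerayHopfLimit_dissipation_tendsto_zero_of_conservative` — conservative limits transmit no
  anomaly.
* `ConvexIntegrationNonLerayDissipationBudgetNarrow` — the narrowed barrier statement (a `Prop`,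
  house style, with its BARRIER block) and `…_holds`.

## References

* T. Buckmaster, V. Vicol, Ann. of Math. 189 (2019), Thm. 1.3 and §1.2 (arXiv:1709.10033, p. 4).
* T. Buckmaster, C. De Lellis, L. Székelyhidi Jr., V. Vicol, Comm. Pure Appl. Math. 72 (2019), Thm. 1.1.
* P. Constantin, W. E, E. S. Titi, Comm. Math. Phys. 165 (1994), 207–209.
* A. Cheskidov, arXiv:2311.04182 (2023), §1.1; A. Cheskidov, Q. Peng, arXiv:2512.24568 (2025),
  (1.5)–(1.9) (p. 2–3) and Rem. 1.5 (p. 3).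
* A. Cheskidov, X. Luo, SIAM J. Math. Anal. 53 (2021) (arXiv:1910.04204), §1 (p. 7 of the arXiv
  text: forces of convex-integration solutions are small only in negative Sobolev norms).
* Y. Brenier, C. De Lellis, L. Székelyhidi Jr., Comm. Math. Phys. 305 (2011), Cor. 1.
* J. Leray, Acta Math. 63 (1934), §III (5.2).
-/

open MeasureTheory Set Filter Topology
open scoped ENNReal NNReal InnerProductSpace RealInnerProductSpace

noncomputable section

namespace Literature.Barriers.AnomalousDissipation

open Literature.Analysis.FunctionSpaces Literature.Analysis.FluidPDE

/-- The flat three-torus `T³ = (ℝ/ℤ)³` (local notation). -/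
local notation "𝕋³" => UnitAddTorus (Fin 3)
/-- Velocity values (local notation). -/
local notation "E³" => EuclideanSpace ℝ (Fin 3)

/-! ## Convergence of `L²` norms and kinetic energies -/

/-- Along an `L²`-convergent sequence `w_n → w'` of `L²` fields the (real) `L²` norms converge:
`|‖w_n‖ - ‖w'‖| ≤ ‖w_n - w'‖ → 0`. [folklore] -/
theorem tendsto_toReal_eLpNorm_of_tendsto_sub {w : ℕ → 𝕋³ → E³} {w' : 𝕋³ → E³}
    (hw : ∀ n, MemLp (w n) 2 volume) (hw' : MemLp w' 2 volume)
    (h : Tendsto (fun n => eLpNorm (w n - w') 2 volume) atTop (𝓝 0)) :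
    Tendsto (fun n => (eLpNorm (w n) 2 volume).toReal) atTop
      (𝓝 (eLpNorm w' 2 volume).toReal) := by
  have he : Tendsto (fun n => (eLpNorm (w n - w') 2 volume).toReal) atTop (𝓝 0) := by
    have h' := (ENNReal.tendsto_toReal ENNReal.zero_ne_top).comp h
    rw [ENNReal.toReal_zero] at h'
    exact h'
  have hup : ∀ n, (eLpNorm (w n) 2 volume).toReal ≤
      (eLpNorm w' 2 volume).toReal + (eLpNorm (w n - w') 2 volume).toReal := by
    intro n
    have h1 : eLpNorm (w n) 2 volume ≤ eLpNorm w' 2 volume + eLpNorm (w n - w') 2 volume :=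
      eLpNorm_le_add_eLpNorm_sub' (hw n) hw'
    have h2 := ENNReal.toReal_mono
      (ENNReal.add_ne_top.2 ⟨hw'.eLpNorm_ne_top, ((hw n).sub hw').eLpNorm_ne_top⟩) h1
    rwa [ENNReal.toReal_add hw'.eLpNorm_ne_top ((hw n).sub hw').eLpNorm_ne_top] at h2
  have hlow : ∀ n, (eLpNorm w' 2 volume).toReal - (eLpNorm (w n - w') 2 volume).toReal ≤
      (eLpNorm (w n) 2 volume).toReal := by
    intro n
    have h1 : eLpNorm w' 2 volume ≤ eLpNorm (w n) 2 volume + eLpNorm (w n - w') 2 volume :=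
      eLpNorm_le_add_eLpNorm_sub hw' (hw n)
    have h2 := ENNReal.toReal_mono
      (ENNReal.add_ne_top.2 ⟨(hw n).eLpNorm_ne_top, ((hw n).sub hw').eLpNorm_ne_top⟩) h1
    rw [ENNReal.toReal_add (hw n).eLpNorm_ne_top ((hw n).sub hw').eLpNorm_ne_top] at h2
    linarith
  refine tendsto_of_tendsto_of_tendsto_of_le_of_le ?_ ?_ hlow hup
  · simpa using (tendsto_const_nhds (x := (eLpNorm w' 2 volume).toReal)).sub he
  · simpa using (tendsto_const_nhds (x := (eLpNorm w' 2 volume).toReal)).add he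

/-- Along an `L²`-convergent sequence the kinetic energies `E(w) = ½‖w‖²_{L²}` converge
(`kineticEnergy_eq_half_toReal_sq`). [folklore] -/
theorem tendsto_kineticEnergy_of_tendsto_sub {w : ℕ → 𝕋³ → E³} {w' : 𝕋³ → E³}
    (hw : ∀ n, MemLp (w n) 2 volume) (hw' : MemLp w' 2 volume)
    (h : Tendsto (fun n => eLpNorm (w n - w') 2 volume) atTop (𝓝 0)) :
    Tendsto (fun n => Torus.kineticEnergy (w n)) atTop (𝓝 (Torus.kineticEnergy w')) := by
  have hT := tendsto_toReal_eLpNorm_of_tendsto_sub hw hw' h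
  have heq : (fun n => Torus.kineticEnergy (w n)) =
      fun n => 2⁻¹ * (eLpNorm (w n) 2 volume).toReal ^ 2 := by
    funext n
    exact kineticEnergy_eq_half_toReal_sq (hw n)
  rw [heq, kineticEnergy_eq_half_toReal_sq hw']
  exact (hT.pow 2).const_mul _

/-! ## The dissipation budget of a Leray–Hopf realisation -/

/-- **Dissipation budget (with forces).** Let `u : ℝ → T³ → ℝ³` have slices in `L²` on `[0,T]`,
`T ≥ 0`, and let `v_n` be Leray–Hopf solutions on `T³ × [0,T)` (accepted `Torus.IsLerayHopfOn`)
with viscosities `ν_n`, forces `f_n` and data `u₀ⁿ ∈ L²` such that `u₀ⁿ → u(0)` in `L²`,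
`sup_{t ∈ [0,T]} ‖v_n(t) - u(t)‖_{L²} → 0` (the convergence of [cite: BuckmasterVicol2019Annals, Thm. 1.3]) and the
works converge, `∫₀ᵀ (f_n, v_n) → W`. Then for every `δ > 0`, eventually
`ν_n ∫₀ᵀ ‖∇v_n‖₂² ≤ E(u(0)) - E(u(T)) + W + δ`: the energy inequality from `0`
[cite: Leray1934, §III (5.2)] gives `ν_n ∫₀ᵀ ‖∇v_n‖₂² ≤ E(u₀ⁿ) - E(v_n(T)) + ∫₀ᵀ(f_n, v_n)`, and
both energies converge (`tendsto_kineticEnergy_of_tendsto_sub`). The dissipation is the spectral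
`(∫⁻ eGradNormSq).toReal` of the accepted energy inequality. [folklore] -/
theorem lerayHopfLimit_dissipation_le {T : ℝ} (hT : 0 ≤ T) {u : ℝ → 𝕋³ → E³}
    (hu : ∀ t ∈ Icc 0 T, MemLp (u t) 2 volume) {ν : ℕ → ℝ} {f : ℕ → ℝ → 𝕋³ → E³}
    {u₀ : ℕ → 𝕋³ → E³} {v : ℕ → ℝ → 𝕋³ → E³} (hu₀ : ∀ n, MemLp (u₀ n) 2 volume)
    (hv : ∀ n, Torus.IsLerayHopfOn T (ν n) (f n) (u₀ n) (v n))
    (hdata : Tendsto (fun n => eLpNorm (u₀ n - u 0) 2 volume) atTop (𝓝 0))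
    (hconv : Tendsto (fun n => ⨆ t ∈ Icc 0 T, eLpNorm (v n t - u t) 2 volume) atTop (𝓝 0))
    {W : ℝ}
    (hwork : Tendsto (fun n => ∫ τ in (0 : ℝ)..T, ∫ x, ⟪f n τ x, v n τ x⟫) atTop (𝓝 W))
    {δ : ℝ} (hδ : 0 < δ) :
    ∀ᶠ n in atTop, ν n * (∫⁻ τ in Ioo 0 T, Torus.eGradNormSq (v n τ)).toReal ≤
      Torus.kineticEnergy (u 0) - Torus.kineticEnergy (u T) + W + δ := by
  have hTmem : T ∈ Icc 0 T := ⟨hT, le_rfl⟩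
  have h0mem : (0 : ℝ) ∈ Icc 0 T := ⟨le_rfl, hT⟩
  -- the energy inequality of each `v n` at the final time
  have hE : ∀ n, ν n * (∫⁻ τ in Ioo 0 T, Torus.eGradNormSq (v n τ)).toReal ≤
      Torus.kineticEnergy (u₀ n) - Torus.kineticEnergy (v n T) +
        ∫ τ in (0 : ℝ)..T, ∫ x, ⟪f n τ x, v n τ x⟫ := by
    intro n
    have h := (hv n).energy_ineq_zero T hTmem
    linarith
  -- both energies converge
  have h1 : Tendsto (fun n => Torus.kineticEnergy (u₀ n)) atTop (𝓝 (Torus.kineticEnergy (u 0))) :=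
    tendsto_kineticEnergy_of_tendsto_sub hu₀ (hu 0 h0mem) hdata
  have h2 : Tendsto (fun n => Torus.kineticEnergy (v n T)) atTop (𝓝 (Torus.kineticEnergy (u T))) :=
    tendsto_kineticEnergy_of_tendsto_sub (fun n => (hv n).memLp T hTmem) (hu T hTmem)
      (tendsto_eLpNorm_slice_of_tendsto_iSup hconv hTmem)
  have h3 : Tendsto (fun n => Torus.kineticEnergy (u₀ n) - Torus.kineticEnergy (v n T) +
      ∫ τ in (0 : ℝ)..T, ∫ x, ⟪f n τ x, v n τ x⟫) atTop
      (𝓝 (Torus.kineticEnergy (u 0) - Torus.kineticEnergy (u T) + W)) :=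
    (h1.sub h2).add hwork
  have h4 : ∀ᶠ n in atTop, Torus.kineticEnergy (u₀ n) - Torus.kineticEnergy (v n T) +
      ∫ τ in (0 : ℝ)..T, ∫ x, ⟪f n τ x, v n τ x⟫ <
        Torus.kineticEnergy (u 0) - Torus.kineticEnergy (u T) + W + δ :=
    h3.eventually (Iio_mem_nhds (by linarith))
  exact h4.mono fun n hn => (hE n).trans hn.le

/-- **Dissipation budget, unforced: at most the energy drop of the limit.** For unforced
Leray–Hopf solutions `v_n` (any viscosities, data `u₀ⁿ → u(0)` in `L²`) converging to `u` in
`C⁰([0,T]; L²)`, and every `δ > 0`: eventually `ν_n ∫₀ᵀ ‖∇v_n‖₂² ≤ E(u(0)) - E(u(T)) + δ` — the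
anomaly such a realisation can transmit is bounded by the realised flow's energy loss (the
`T³`/Leray–Hopf form of `D(t) ≤ ‖u_in‖² - ‖u(t)‖²` for zero work, [cite: Cheskidov2023, §1.1]). [folklore] -/
theorem lerayHopfLimit_dissipation_le_energyDrop {T : ℝ} (hT : 0 ≤ T) {u : ℝ → 𝕋³ → E³}
    (hu : ∀ t ∈ Icc 0 T, MemLp (u t) 2 volume) {ν : ℕ → ℝ} {u₀ : ℕ → 𝕋³ → E³}
    {v : ℕ → ℝ → 𝕋³ → E³} (hu₀ : ∀ n, MemLp (u₀ n) 2 volume)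
    (hv : ∀ n, Torus.IsLerayHopfOn T (ν n) 0 (u₀ n) (v n))
    (hdata : Tendsto (fun n => eLpNorm (u₀ n - u 0) 2 volume) atTop (𝓝 0))
    (hconv : Tendsto (fun n => ⨆ t ∈ Icc 0 T, eLpNorm (v n t - u t) 2 volume) atTop (𝓝 0))
    {δ : ℝ} (hδ : 0 < δ) :
    ∀ᶠ n in atTop, ν n * (∫⁻ τ in Ioo 0 T, Torus.eGradNormSq (v n τ)).toReal ≤
      Torus.kineticEnergy (u 0) - Torus.kineticEnergy (u T) + δ := by
  have hwork : Tendsto (fun n => ∫ τ in (0 : ℝ)..T, ∫ x, ⟪(0 : ℝ → 𝕋³ → E³) τ x, v n τ x⟫)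
      atTop (𝓝 0) := by
    simp only [Pi.zero_apply, inner_zero_left, integral_zero, intervalIntegral.integral_zero]
    exact tendsto_const_nhds
  have h := lerayHopfLimit_dissipation_le (f := fun _ => 0) hT hu hu₀ hv hdata hconv hwork hδ
  simpa using h

/-- **No anomaly beyond the energy drop.** Under the same hypotheses, if the realised flow loses
less than `ε` of kinetic energy over `[0,T]`, `E(u(0)) - E(u(T)) < ε`, then eventually
`ν_n ∫₀ᵀ ‖∇v_n‖₂² < ε`: a dissipation anomaly of size `ε` on `[0,T]` cannot be obtained from a
`C⁰_t L²` Leray–Hopf realisation of such a flow. [folklore] -/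
theorem lerayHopfLimit_eventually_dissipation_lt {T : ℝ} (hT : 0 ≤ T) {u : ℝ → 𝕋³ → E³}
    (hu : ∀ t ∈ Icc 0 T, MemLp (u t) 2 volume) {ν : ℕ → ℝ} {u₀ : ℕ → 𝕋³ → E³}
    {v : ℕ → ℝ → 𝕋³ → E³} (hu₀ : ∀ n, MemLp (u₀ n) 2 volume)
    (hv : ∀ n, Torus.IsLerayHopfOn T (ν n) 0 (u₀ n) (v n))
    (hdata : Tendsto (fun n => eLpNorm (u₀ n - u 0) 2 volume) atTop (𝓝 0))
    (hconv : Tendsto (fun n => ⨆ t ∈ Icc 0 T, eLpNorm (v n t - u t) 2 volume) atTop (𝓝 0))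
    {ε : ℝ} (hε : Torus.kineticEnergy (u 0) - Torus.kineticEnergy (u T) < ε) :
    ∀ᶠ n in atTop, ν n * (∫⁻ τ in Ioo 0 T, Torus.eGradNormSq (v n τ)).toReal < ε := by
  have hδ : 0 < (ε - (Torus.kineticEnergy (u 0) - Torus.kineticEnergy (u T))) / 2 := by linarith
  filter_upwards [lerayHopfLimit_dissipation_le_energyDrop hT hu hu₀ hv hdata hconv hδ] with n hn
  linarith

/-- **Conservative limits transmit no anomaly.** Under the same hypotheses with `ν_n ≥ 0`, if the
realised flow has the same kinetic energy at `T` as at `0` — every energy-conservative weak Euler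
flow, e.g. the Onsager-flexibility flows with constant prescribed profile [cite: BDLSV2019, Thm. 1.1]
or any weak Euler flow in `C^β`, `β > 1/3` [cite: ConstantinETiti1994, p. 207] — then
`ν_n ∫₀ᵀ ‖∇v_n‖₂² → 0`: no anomalous dissipation on `[0,T]` along the realising family, with no
regularity or uniform bound assumed on the `v_n` (contrast [cite: BrenierDeLellisSzekelyhidi2011, Cor. 1]). [folklore] -/
theorem lerayHopfLimit_dissipation_tendsto_zero_of_conservative {T : ℝ} (hT : 0 ≤ T)
    {u : ℝ → 𝕋³ → E³} (hu : ∀ t ∈ Icc 0 T, MemLp (u t) 2 volume) {ν : ℕ → ℝ}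
    {u₀ : ℕ → 𝕋³ → E³} {v : ℕ → ℝ → 𝕋³ → E³} (hν : ∀ n, 0 ≤ ν n)
    (hu₀ : ∀ n, MemLp (u₀ n) 2 volume) (hv : ∀ n, Torus.IsLerayHopfOn T (ν n) 0 (u₀ n) (v n))
    (hdata : Tendsto (fun n => eLpNorm (u₀ n - u 0) 2 volume) atTop (𝓝 0))
    (hconv : Tendsto (fun n => ⨆ t ∈ Icc 0 T, eLpNorm (v n t - u t) 2 volume) atTop (𝓝 0))
    (hcons : Torus.kineticEnergy (u T) = Torus.kineticEnergy (u 0)) :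
    Tendsto (fun n => ν n * (∫⁻ τ in Ioo 0 T, Torus.eGradNormSq (v n τ)).toReal) atTop (𝓝 0) := by
  refine tendsto_order.2 ⟨fun a ha => Eventually.of_forall fun n => ?_, fun b hb => ?_⟩
  · exact ha.trans_le (mul_nonneg (hν n) ENNReal.toReal_nonneg)
  · have hε : Torus.kineticEnergy (u 0) - Torus.kineticEnergy (u T) < b := by rw [hcons]; linarith
    exact lerayHopfLimit_eventually_dissipation_lt hT hu hu₀ hv hdata hconv hε

/-! ## The narrowed barrier statement -/

/-- **Narrowed barrier (dissipation budget): a `C⁰_t L²` Leray–Hopf realisation transmits at most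
the realised flow's energy drop as anomalous dissipation** (second narrowing — after
`ConvexIntegrationNonLerayEnergyCeilingNarrow` — of the block of `BuckmasterVicol2019_thm13`, whose
`blocks:` line bars the "transfer of the Onsager-flexibility constructions … into a witness for
`Literature.Turb.ZerothLaw`"). For every `T ≥ 0`, every `u : ℝ → T³ → ℝ³` with slices in `L²` on
`[0,T]`, every sequence of unforced Leray–Hopf solutions `v_n` on `T³ × [0,T)` (accepted
`Torus.IsLerayHopfOn T ν_n 0 u₀ⁿ v_n`; any viscosities, data `u₀ⁿ ∈ L²`) with `u₀ⁿ → u(0)` in `L²` and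
`sup_{t ∈ [0,T]} ‖v_n(t) - u(t)‖_{L²} → 0` — the convergence of [cite: BuckmasterVicol2019Annals, Thm. 1.3] —
and every `δ > 0`: eventually `ν_n ∫₀ᵀ ‖∇v_n‖₂² ≤ E(u(0)) - E(u(T)) + δ` (`E = Torus.kineticEnergy`;
the dissipation is the spectral `(∫⁻ eGradNormSq).toReal` of the Leray–Hopf energy inequality).

BARRIER (D-0021):
- technique_class: convex-integration onsager-flexibility prescribed-energy-profile energy-conservative-wild-solutions vanishing-viscosity-limit unforced-leray-hopf energy-inequality euler-limit-route
- blocks: extraction of a dissipation anomaly of size `ε` on `[0,T]` — `ν_n ∫₀ᵀ ‖∇v_n‖₂² ≥ ε` along the family — from a `C⁰_t L²_x` Leray–Hopf realisation with `L²`-convergent data of ANY weak Euler flow `u` on `T³` whose energy drop `E(u(0)) - E(u(T))` is `< ε` (`lerayHopfLimit_eventually_dissipation_lt`); in particular the energy-conservative flexible flows — the witnesses of `Literature.Analysis.FluidPDE.onsager_flexibility` for constant profiles [cite: BDLSV2019, Thm. 1.1], every weak Euler flow in `C^β`, `β > 1/3` [cite: ConstantinETiti1994, p. 207] — transmit NO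 anomaly even if the open Leray–Hopf realisation [cite: BuckmasterVicol2019Annals, §1.2] were available for them (`lerayHopfLimit_dissipation_tendsto_zero_of_conservative`), with no regularity or uniform bound assumed on the approximants (contrast [cite: BrenierDeLellisSzekelyhidi2011, Cor. 1], where the limit must be regular and the strong convergence is derived); hence a `ZerothLaw` witness through an Euler-limit line (route EulerLimit) must realise a STRICTLY dissipative flow and harvests at most its designed energy loss per unit time.
- because: the Leray–Hopf energy inequality from `0` [cite: Leray1934, §III (5.2)] reads `E(v_n(T)) + ν_n ∫₀ᵀ ‖∇v_n‖₂² ≤ E(u₀ⁿ) + ∫₀ᵀ (f_n, v_n)`; under `L²` convergence `u₀ⁿ → u(0)`, `v_n(T) → u(T)` both energies converge (`tendsto_kineticEnergy_of_tendsto_sub`), so the dissipation is eventually below `E(u(0)) - E(u(T)) + lim_n ∫₀ᵀ(f_n, v_n) + δ` (`lerayHopfLimit_dissipation_le`; zero work term when unforced) — the inequality `D(t) ≤ ‖u_in‖² - ‖u(t)‖² + W(t)` ("dissipation anomaly implies anomalous dissipation") of [cite: Cheskidov2023, §1.1] and [cite: CheskidovPeng2025, §1 (1.9)], read on `T³` for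 Leray–Hopf families with strongly convergent data [folklore].
- evasions_known: none (a theorem); it is void — no constraint — exactly when the realised flow dissipates at least `ε` over `[0,T]`, which is where the parent's documented gap lives (globally dissipative convex-integration flows with `D(u) ≥ 0`, [cite: GiriKwonNovack2026, Thm. 1.1]; "still not known to arise as vanishing-viscosity limits of physical Navier–Stokes solutions" [cite: CheskidovPeng2025, §1 and Rem. 1.5]); with forces the budget gains the limiting work `W = lim_n ∫₀ᵀ (f_n, v_n)` (`lerayHopfLimit_dissipation_le`) — equal to `∫₀ᵀ (f, u)` for one steady `f ∈ L²` (the summit's setting; route EulerLimit reads the anomaly off the exact period balance of classical flows instead), convergent whenever `f_n → f` in `L¹_t L²_x` [cite: CheskidovPeng2025, §1 (1.7)], but uncontrolled for the `ν`-dependent forces convex integration delivers, which are small only in negative Sobolev norms ("the force can be made arbitrarily small in `L^∞_t W^{-1,1}`" [cite: CheskidovLuo2021, §1]; work `≈ ν^{(3β-1)/(1+β)}` in the calibration of [cite: BuckmasterVicol2020, Rem. 6.4]).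
- scope_caveats: `C⁰([0,T]; L²)` convergence with `L²`-convergent data, as in [cite: BuckmasterVicol2019Annals, Thm. 1.3] (for `L^p_{t,x}` convergence only an a.e.-in-time budget between good times survives, not proved here); an upper bound only — the equality `lim ν_n ∫₀ᵀ ‖∇v_n‖₂² = E(u(0)) - E(u(T))` needs the energy EQUALITY of the approximants (classical solutions) and is not claimed; the dissipation is the spectral `(∫⁻ eGradNormSq).toReal` of the accepted Leray–Hopf energy inequality (for classical approximants it is `Torus.cumulativeDissipation`, via `gradNormSq_eq_toReal_eGradNormSq`, not restated here); nothing is said about weak (Oseen) approximants, for which `∇v_n ∉ L²_{t,x}` is allowed and Thm. 1.3 realises every Hölder flow.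
- status: established (theorem `ConvexIntegrationNonLerayDissipationBudgetNarrow_holds` below) [folklore] -/
def ConvexIntegrationNonLerayDissipationBudgetNarrow : Prop :=
  ∀ (T : ℝ), 0 ≤ T → ∀ (u : ℝ → 𝕋³ → E³), (∀ t ∈ Icc 0 T, MemLp (u t) 2 volume) →
  ∀ (ν : ℕ → ℝ) (u₀ : ℕ → 𝕋³ → E³) (v : ℕ → ℝ → 𝕋³ → E³), (∀ n, MemLp (u₀ n) 2 volume) →
    (∀ n, Torus.IsLerayHopfOn T (ν n) 0 (u₀ n) (v n)) →
    Tendsto (fun n => eLpNorm (u₀ n - u 0) 2 volume) atTop (𝓝 0) →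
    Tendsto (fun n => ⨆ t ∈ Icc 0 T, eLpNorm (v n t - u t) 2 volume) atTop (𝓝 0) →
    ∀ δ : ℝ, 0 < δ → ∀ᶠ n in atTop,
      ν n * (∫⁻ τ in Ioo 0 T, Torus.eGradNormSq (v n τ)).toReal ≤
        Torus.kineticEnergy (u 0) - Torus.kineticEnergy (u T) + δ

/-- The narrowed barrier holds (it is `lerayHopfLimit_dissipation_le_energyDrop`). [folklore] -/
theorem ConvexIntegrationNonLerayDissipationBudgetNarrow_holds :
    ConvexIntegrationNonLerayDissipationBudgetNarrow :=
  fun _T hT _u hu _ν _u₀ _v hu₀ hv hdata hconv _δ hδ =>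
    lerayHopfLimit_dissipation_le_energyDrop hT hu hu₀ hv hdata hconv hδ

/-! ## Forced approximants with vanishing work (generation-10 audit) -/

/-- **Energy gain under vanishing work excludes Leray–Hopf realisation, whatever the forces.**
If the field `u` (slices in `L²` on `[0,T]`) has more kinetic energy at `T` than at `0`,
`E(u(0)) < E(u(T))`, then there are NO viscosities `ν_n ≥ 0`, forces `f_n`, data `u₀ⁿ → u(0)` in
`L²` and Leray–Hopf solutions `v_n` for those forces with `sup_{[0,T]} ‖v_n - u‖_{L²} → 0` whose
works vanish, `∫₀ᵀ (f_n, v_n) → 0`: by `lerayHopfLimit_dissipation_le` with `W = 0` the nonnegative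
dissipation `ν_n ∫₀ᵀ ‖∇v_n‖₂²` would eventually lie below the negative energy drop. The forces may be
`ν`-dependent and of any size (e.g. `L²_x`-orthogonal to `v_n(t)` at each time); only their work
enters. With the energy ceiling of the sibling file `ConvexIntegrationNonLerayEnergyCeiling` this is
the work-functional form of the force-axis dichotomy recorded in the parent block (caveats (x), (z)):
a Hölder weak Euler flow whose energy is not monotone — the Baire-typical one,
[cite: DeRosaTione2022, Thm. 1.2] — is realised classically by forces small in `W^{-1,∞}` doing
non-vanishing work (`holderEuler_lerayHopf_realisation_smallForce` of
`ConvexIntegrationNonLerayForceTopology`) and by no Leray–Hopf family whose works vanish. [folklore] -/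
theorem not_lerayHopfLimit_of_kineticEnergy_lt_of_work_tendsto_zero {T : ℝ} (hT : 0 ≤ T)
    {u : ℝ → 𝕋³ → E³} (hu : ∀ t ∈ Icc 0 T, MemLp (u t) 2 volume)
    (hgain : Torus.kineticEnergy (u 0) < Torus.kineticEnergy (u T)) :
    ¬ ∃ (ν : ℕ → ℝ) (f : ℕ → ℝ → 𝕋³ → E³) (u₀ : ℕ → 𝕋³ → E³) (v : ℕ → ℝ → 𝕋³ → E³),
        (∀ n, 0 ≤ ν n) ∧ (∀ n, MemLp (u₀ n) 2 volume) ∧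
        (∀ n, Torus.IsLerayHopfOn T (ν n) (f n) (u₀ n) (v n)) ∧
        Tendsto (fun n => eLpNorm (u₀ n - u 0) 2 volume) atTop (𝓝 0) ∧
        Tendsto (fun n => ⨆ s ∈ Icc 0 T, eLpNorm (v n s - u s) 2 volume) atTop (𝓝 0) ∧
        Tendsto (fun n => ∫ τ in (0 : ℝ)..T, ∫ x, ⟪f n τ x, v n τ x⟫) atTop (𝓝 0) := by
  rintro ⟨ν, f, u₀, v, hν, hu₀, hv, hdata, hconv, hwork⟩
  have hδ : 0 < (Torus.kineticEnergy (u T) - Torus.kineticEnergy (u 0)) / 2 := by linarith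
  obtain ⟨n, hn⟩ := (lerayHopfLimit_dissipation_le hT hu hu₀ hv hdata hconv hwork hδ).exists
  have h0 : 0 ≤ ν n * (∫⁻ τ in Ioo 0 T, Torus.eGradNormSq (v n τ)).toReal :=
    mul_nonneg (hν n) ENNReal.toReal_nonneg
  linarith

/-- **In particular for unforced or work-free approximants of a flow gaining energy from its initial
time** — the form used for the Baire-typical flexible flows of [cite: DeRosaTione2022, Thm. 1.2],
whose energy, being monotone on no interval, rises strictly after densely many initial times: for
such a time `t₀` apply the theorem to `u(t₀ + ·)` on `[0, t - t₀]`. Stated here for a flow at REST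
at `t = 0` and non-trivial at `T` (the compactly time-supported flows of [cite: Isett2018, Thm. 1]
after a time shift), now with arbitrary forces of vanishing work. [folklore] -/
theorem not_lerayHopfLimit_of_rest_of_work_tendsto_zero {T : ℝ} (hT : 0 ≤ T)
    {u : ℝ → 𝕋³ → E³} (hu : ∀ t ∈ Icc 0 T, MemLp (u t) 2 volume) (hrest : u 0 = 0)
    (hne : eLpNorm (u T) 2 volume ≠ 0) :
    ¬ ∃ (ν : ℕ → ℝ) (f : ℕ → ℝ → 𝕋³ → E³) (u₀ : ℕ → 𝕋³ → E³) (v : ℕ → ℝ → 𝕋³ → E³),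
        (∀ n, 0 ≤ ν n) ∧ (∀ n, MemLp (u₀ n) 2 volume) ∧
        (∀ n, Torus.IsLerayHopfOn T (ν n) (f n) (u₀ n) (v n)) ∧
        Tendsto (fun n => eLpNorm (u₀ n - u 0) 2 volume) atTop (𝓝 0) ∧
        Tendsto (fun n => ⨆ s ∈ Icc 0 T, eLpNorm (v n s - u s) 2 volume) atTop (𝓝 0) ∧
        Tendsto (fun n => ∫ τ in (0 : ℝ)..T, ∫ x, ⟪f n τ x, v n τ x⟫) atTop (𝓝 0) := by
  refine not_lerayHopfLimit_of_kineticEnergy_lt_of_work_tendsto_zero hT hu ?_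
  have hTmem : T ∈ Icc 0 T := ⟨hT, le_rfl⟩
  have hpos : 0 < (eLpNorm (u T) 2 volume).toReal :=
    ENNReal.toReal_pos hne (hu T hTmem).eLpNorm_ne_top
  rw [kineticEnergy_eq_half_toReal_sq (hu T hTmem), hrest]
  have h0 : Torus.kineticEnergy (0 : 𝕋³ → E³) = 0 := by
    simp [Torus.kineticEnergy]
  rw [h0]
  exact mul_pos (by norm_num) (pow_pos hpos 2)

end Literature.Barriers.AnomalousDissipation

end
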